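import Literature.Topology.FourManifolds.OneHandlebodyFundamentalGroup
import Literature.AlgebraicTopology.FundamentalGroup.CellAttachmentKernel
import HarnessLib

/-!
# `π₁` across one critical level of a Morse function on a cobordism (Milnor 1965, Thm. 3.14
# read through van Kampen; Hatcher, Prop. 1.26)

Topic `Literature/Topology/FourManifolds` (infrastructure for the fact seat
`provefact-Literature.Topology.FourManifolds.Mazur1961_double_sphere_four`: the fundamental
group of the level between the `1`-handle and the `2`-handle of a Mazur-type handlebody).
Everything here is **proved**; no definitions, no named facts.

Milnor, *Lectures on the h-cobordism theorem* (1965), Thm. 3.14 with its Remark (PDF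
pp. 19–21) and the van Kampen remarks on PDF pp. 38, 56: a slab `f⁻¹[a, t₂]` of a cobordism
containing exactly one critical point `q` above the non-critical level `t₁` deformation retracts
onto `f⁻¹[a, t₁] ∪ D_L(q)`, the left-hand disc of `q` down to the level `t₁` (a closed cell of
dimension `index(q)`, Def. 3.9, attached along its boundary sphere in `f⁻¹(t₁)`).  Hence, by
Hatcher's Prop. 1.26 (the tree's `CellAttachmentPi1.lean`, `CellAttachmentKernel.lean`) and
Prop. 1.17 (`DeformationRetractInclusion.lean`), for the homomorphism
`π₁(f⁻¹[a, t₁], x₀) → π₁(f⁻¹[a, t₂], x₀)` induced by the inclusion: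

* `Cobordism.pi1_slab_single` — if `index(q) ≥ 2` it is surjective, `f⁻¹[a, t₂]` is path
  connected, and (base point on the attaching sphere) its kernel is contained in the normal
  closure of the image of `π₁` of the attaching sphere `f⁻¹[a, t₁] ∩ D_L(q)`; if `index(q) ≥ 3`
  it is bijective.

The simple-connectivity shadow of this statement is the tree's
`Cobordism.isSimplyConnected_slab_step` (`HCobordismLevelConnectivity.lean`), whose proof is
followed here word for word, with `Cobordism.isStrongDeformationRetractOf_sublevel_union_leftHandDiscs`
(`OneHandlebodyFundamentalGroup.lean`) for the deformation retraction.

## References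

* J. Milnor, *Lectures on the h-cobordism theorem*, Princeton (1965), Def. 3.9 (PDF p. 16),
  Thm. 3.14 and Remark (PDF pp. 19–21), Remark 1 after Thm. 6.4 (PDF p. 38), proof of
  Thm. 8.1 (PDF p. 56). [MilnorHCobordism1965]
* A. Hatcher, *Algebraic Topology*, CUP (2002), Prop. 1.17, Prop. 1.26. [HatcherAT2002]
-/

open scoped Manifold ContDiff Topology
open Set Function Filter Metric

noncomputable section

namespace Literature.Topology.FourManifolds

open Literature.AlgebraicTopology Literature.AlgebraicTopology.FundamentalGroup
  Literature.AlgebraicTopology.FundamentalGroup.VanKampen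

universe u

variable {n : ℕ} {M N : Type u} [TopologicalSpace M] [T2Space M] [SecondCountableTopology M]
  [ChartedSpace (EuclideanSpace ℝ (Fin n)) M] [IsManifold (𝓡 n) ∞ M] [CompactSpace M]
  [TopologicalSpace N] [T2Space N] [SecondCountableTopology N]
  [ChartedSpace (EuclideanSpace ℝ (Fin n)) N] [IsManifold (𝓡 n) ∞ N] [CompactSpace N]

/-- **One critical level, `π₁` form (Milnor 1965, Thm. 3.14 and Remark through Hatcher's
Prop. 1.26).**  Let `f` be a Morse function on the cobordism `c` with smooth gradient-like `ξ`,
`0 ≤ a ≤ t₁ < t₂ ≤ 1` with `t₁`, `t₂` not critical values, and suppose `q` is the only critical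
point of `f` in `f⁻¹(t₁, t₂)`.  Let `f⁻¹[a, t₁]` be path connected and `x₀ ∈ f⁻¹[a, t₁]`.  For
the homomorphism `π₁(f⁻¹[a, t₁], x₀) → π₁(f⁻¹[a, t₂], x₀)` induced by the inclusion:
(1) if `index(q) ≥ 2` then `f⁻¹[a, t₂]` is path connected and the homomorphism is surjective;
(2) if `index(q) ≥ 3` it is bijective; (3) if `index(q) ≥ 2` and `x₀` lies on the left-hand disc
`D_L(q)` of `q` down to `t₁` (so on the attaching sphere `f⁻¹[a, t₁] ∩ D_L(q)`), its kernel is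
contained in the normal closure of the image of `π₁(f⁻¹[a, t₁] ∩ D_L(q), x₀)`.  Proof: the slab
deformation retracts onto `f⁻¹[a, t₁] ∪ D_L(q)` (3.14), a closed `index(q)`-cell attached along
its boundary sphere (Def. 3.9), and Hatcher's Prop. 1.26 / Prop. 1.17.
[cite: MilnorHCobordism1965, Thm. 3.14 and Remark (PDF pp. 19–21), Def. 3.9 (PDF p. 16), proof of Thm. 8.1 (PDF p. 56)] [cite: HatcherAT2002, Prop. 1.26 and Prop. 1.17] -/
theorem Cobordism.pi1_slab_single
    {c : Cobordism n M N} {f : c.W → ℝ} (hf : c.IsMorseFunction f)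
    (ξ : Cₛ^∞⟮𝓡∂ (n + 1); EuclideanSpace ℝ (Fin (n + 1)), (TangentSpace (𝓡∂ (n + 1)) : c.W → Type)⟯)
    (hξ : IsGradientLike (𝓡∂ (n + 1)) f ξ) {a t₁ t₂ : ℝ} (ha : 0 ≤ a) (hat : a ≤ t₁)
    (ht : t₁ < t₂) (ht₂ : t₂ ≤ 1)
    (hreg : ∀ z ∈ criticalSet (𝓡∂ (n + 1)) f, f z ≠ t₁ ∧ f z ≠ t₂) {q : c.W}
    (hq : criticalSet (𝓡∂ (n + 1)) f ∩ f ⁻¹' Ioo t₁ t₂ = {q})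
    (hpc : IsPathConnected (f ⁻¹' Icc a t₁)) {x₀ : c.W} (hx₀ : x₀ ∈ f ⁻¹' Icc a t₁)
    (hsub : f ⁻¹' Icc a t₁ ⊆ f ⁻¹' Icc a t₂) :
    (2 ≤ morseIndex (𝓡∂ (n + 1)) f q →
      IsPathConnected (f ⁻¹' Icc a t₂) ∧
        Surjective (inclHomOfSubset hsub x₀ hx₀ (hsub hx₀))) ∧
    (3 ≤ morseIndex (𝓡∂ (n + 1)) f q → Bijective (inclHomOfSubset hsub x₀ hx₀ (hsub hx₀))) ∧
    (2 ≤ morseIndex (𝓡∂ (n + 1)) f q →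
      ∀ hx₀D : x₀ ∈ leftHandDisc (𝓡∂ (n + 1)) f ξ q t₁,
        (inclHomOfSubset hsub x₀ hx₀ (hsub hx₀)).ker ≤
          Subgroup.normalClosure (Set.range (inclHomOfSubset
            (inter_subset_left :
              f ⁻¹' Icc a t₁ ∩ leftHandDisc (𝓡∂ (n + 1)) f ξ q t₁ ⊆ f ⁻¹' Icc a t₁)
            x₀ ⟨hx₀, hx₀D⟩ hx₀))) := by
  classical
  set S₁ : Set c.W := f ⁻¹' Icc a t₁ with hS₁
  set S₂ : Set c.W := f ⁻¹' Icc a t₂ with hS₂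
  set P : Set c.W := criticalSet (𝓡∂ (n + 1)) f ∩ f ⁻¹' Ioo t₁ t₂ with hP
  set D : Set c.W := leftHandDisc (𝓡∂ (n + 1)) f ξ q t₁ with hD
  have hfc : Continuous f := hf.isMorse.contMDiff.continuous
  have hfd : MDifferentiable (𝓡∂ (n + 1)) 𝓘(ℝ, ℝ) f :=
    hf.isMorse.contMDiff.mdifferentiable (by simp)
  have hS₁cl : IsClosed S₁ := isClosed_Icc.preimage hfc
  have hqP : q ∈ P := by rw [hq]; exact mem_singleton q
  have hqc : q ∈ criticalSet (𝓡∂ (n + 1)) f := hqP.1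
  have hqv : f q ∈ Ioo t₁ t₂ := hqP.2
  have hlev : ∀ z ∈ criticalSet (𝓡∂ (n + 1)) f, ∀ z' ∈ criticalSet (𝓡∂ (n + 1)) f,
      f z ∈ Ioo t₁ t₂ → f z' ∈ Ioo t₁ t₂ → f z = f z' := by
    intro z hz z' hz' hzI hz'I
    have h1 : z ∈ P := ⟨hz, hzI⟩
    have h2 : z' ∈ P := ⟨hz', hz'I⟩
    rw [hq, mem_singleton_iff] at h1 h2
    rw [h1, h2]
  ----------------------------------------------------------------------------------------------
  -- Step 1 (3.14): `S₂` strong deformation retracts onto `S₁ ∪ D`.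
  ----------------------------------------------------------------------------------------------
  have hsdr' := Cobordism.isStrongDeformationRetractOf_sublevel_union_leftHandDiscs hf ξ hξ ha hat
    ht ht₂ hreg hlev
  have hUeq : (S₁ ∪ ⋃ p ∈ P, leftHandDisc (𝓡∂ (n + 1)) f ξ p t₁) = S₁ ∪ D := by
    rw [hq]
    simp [hD]
  have hsdr : Homotopy.IsStrongDeformationRetractOf (S₁ ∪ D) S₂ := by rw [← hUeq]; exact hsdr'
  -- the disc lies in `S₂`, above the level `t₁`
  have hDval : ∀ x ∈ D, t₁ ≤ f x ∧ f x ≤ f q := fun x hx =>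
    ⟨hx.2, hξ.apply_le_of_mem_stableSet hfd hx.1⟩
  have hDS₂ : D ⊆ S₂ := fun x hx =>
    ⟨hat.trans (hDval x hx).1, (hDval x hx).2.trans hqv.2.le⟩
  have hUS₂ : S₁ ∪ D ⊆ S₂ := union_subset hsub hDS₂
  ----------------------------------------------------------------------------------------------
  -- Step 2 (3.9): `D` is a closed cell attached to `S₁` along its boundary sphere.
  ----------------------------------------------------------------------------------------------
  have hnoval : ∀ z ∈ criticalSet (𝓡∂ (n + 1)) f, f z ∉ Ico t₁ (f q) := by
    intro z hz hzI
    have hzt : f z ∈ Ioo t₁ t₂ :=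
      ⟨lt_of_le_of_ne hzI.1 (hreg z hz).1.symm, hzI.2.trans hqv.2⟩
    exact (hlev z hz q hqc hzt hqv ▸ hzI.2).false
  obtain ⟨Φ, hΦinj, hΦrange, hΦlev⟩ :=
    Cobordism.Milnor1965_leftHandDisc_isDisc_holds hf ξ hξ (ha.trans hat) hqc hqv.1 hnoval
  have hmem : ∀ x, Φ x ∈ S₁ ↔
      ‖(x : EuclideanSpace ℝ (Fin (morseIndex (𝓡∂ (n + 1)) f q)))‖ = 1 := by
    intro x
    rw [← hΦlev x]
    have hxD : Φ x ∈ D := by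
      have h := mem_range_self (f := Φ) x
      rw [hΦrange] at h
      exact h
    constructor
    · intro hx
      exact le_antisymm hx.2 (hDval _ hxD).1
    · intro hx
      exact ⟨hat.trans_eq hx.symm, hx.le⟩
  have hrk : Module.finrank ℝ (EuclideanSpace ℝ (Fin (morseIndex (𝓡∂ (n + 1)) f q))) =
      morseIndex (𝓡∂ (n + 1)) f q := finrank_euclideanSpace_fin
  have hunion : S₁ ∪ range Φ = S₁ ∪ D := by rw [hΦrange]
  have hUsub : S₁ ⊆ S₁ ∪ range Φ := subset_union_left
  have hU'S₂ : S₁ ∪ range Φ ⊆ S₂ := by rw [hunion]; exact hUS₂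
  have hsdrΦ : Homotopy.IsStrongDeformationRetractOf (S₁ ∪ range Φ) S₂ := by
    rw [hunion]; exact hsdr
  -- Prop. 1.17: `π₁(S₁ ∪ Φ(D)) → π₁(S₂)` is bijective
  have hbij₂ : Bijective (inclHomOfSubset hU'S₂ x₀ (hUsub hx₀) (hU'S₂ (hUsub hx₀))) :=
    bijective_inclHomOfSubset_of_isStrongDeformationRetractOf hsdrΦ hU'S₂ (hUsub hx₀)
  -- the factorisation `S₁ ⊆ S₁ ∪ Φ(D) ⊆ S₂`
  have hfac : ∀ z, inclHomOfSubset hsub x₀ hx₀ (hsub hx₀) z =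
      inclHomOfSubset hU'S₂ x₀ (hUsub hx₀) (hU'S₂ (hUsub hx₀))
        (inclHomOfSubset hUsub x₀ hx₀ (hUsub hx₀) z) := fun z =>
    (inclHomOfSubset_inclHomOfSubset hUsub hU'S₂ hx₀ (hUsub hx₀) (hU'S₂ (hUsub hx₀)) z).symm
  -- Prop. 1.26 for the single cell
  have h126 := fun hk : 2 ≤ morseIndex (𝓡∂ (n + 1)) f q =>
    surjective_and_injective_inclHomOfSubset_union_range (Z := c.W) Φ hS₁cl hpc hmem hΦinj
      (by rw [hrk]; exact hk) hx₀
  refine ⟨fun hk => ⟨?_, ?_⟩, fun hk => ?_, fun hk hx₀D => ?_⟩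
  · -- path connectedness of `S₂`
    refine hsdrΦ.isPathConnected ?_
    rw [inter_eq_left.2 hU'S₂]
    have hpos : 0 < Module.finrank ℝ (EuclideanSpace ℝ (Fin (morseIndex (𝓡∂ (n + 1)) f q))) := by
      rw [hrk]; omega
    haveI : Nontrivial (EuclideanSpace ℝ (Fin (morseIndex (𝓡∂ (n + 1)) f q))) :=
      Module.nontrivial_of_finrank_pos hpos
    obtain ⟨v, hv⟩ : (sphere (0 : EuclideanSpace ℝ (Fin (morseIndex (𝓡∂ (n + 1)) f q))) 1).Nonempty :=
      NormedSpace.sphere_nonempty.2 zero_le_one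
    have hv1 : ‖v‖ = 1 := by simpa using hv
    have hvB : v ∈ closedBall (0 : EuclideanSpace ℝ (Fin (morseIndex (𝓡∂ (n + 1)) f q))) 1 := by
      rw [mem_closedBall, dist_zero_right, hv1]
    haveI : PathConnectedSpace
        ↥(closedBall (0 : EuclideanSpace ℝ (Fin (morseIndex (𝓡∂ (n + 1)) f q))) 1) :=
      isPathConnected_iff_pathConnectedSpace.1
        ((convex_closedBall _ _).isPathConnected ⟨0, mem_closedBall_self zero_le_one⟩)
    exact hpc.union (isPathConnected_range Φ.continuous)
      ⟨Φ ⟨v, hvB⟩, (hmem ⟨v, hvB⟩).2 hv1, mem_range_self _⟩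
  · -- surjectivity
    intro y
    obtain ⟨w, hw⟩ := hbij₂.2 y
    obtain ⟨z, hz⟩ := (h126 hk).1 w
    exact ⟨z, by rw [hfac, hz, hw]⟩
  · -- bijectivity for cells of dimension `≥ 3`
    have hinj₁ := (h126 (by omega)).2 (by rw [hrk]; exact hk)
    have hsur₁ := (h126 (by omega)).1
    constructor
    · intro z z' h
      rw [hfac, hfac] at h
      exact hinj₁ (hbij₂.1 h)
    · intro y
      obtain ⟨w, hw⟩ := hbij₂.2 y
      obtain ⟨z, hz⟩ := hsur₁ w
      exact ⟨z, by rw [hfac, hz, hw]⟩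
  · -- the kernel, base point on the attaching sphere
    have hx₀' : x₀ ∈ S₁ ∩ range Φ := ⟨hx₀, by rw [hΦrange]; exact hx₀D⟩
    have hker := ker_inclHomOfSubset_union_range (Z := c.W) Φ hS₁cl hpc hmem hΦinj
      (by rw [hrk]; exact hk) hx₀'
    intro z hz
    rw [MonoidHom.mem_ker, hfac] at hz
    have hz' : inclHomOfSubset hUsub x₀ hx₀ (hUsub hx₀) z = 1 :=
      hbij₂.1 (by rw [hz, map_one])
    have hz'' : z ∈ (inclHomOfSubset hUsub x₀ hx₀ (hUsub hx₀)).ker := hz'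
    rw [hker] at hz''
    have hKeq : S₁ ∩ range Φ = S₁ ∩ D := by rw [hΦrange]
    rwa [range_inclHomOfSubset_congr hKeq inter_subset_left inter_subset_left] at hz''
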